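import Summits.Ventures.CertifiedManyBodySolver.Downfold.EmeryAxialSlabHg1212Windows
import Summits.Ventures.CertifiedManyBodySolver.Downfold.EmeryFermiFillingHg1212
import Summits.Ventures.CertifiedManyBodySolver.Downfold.EmeryFermiFillingLa214
import Summits.Ventures.CertifiedManyBodySolver.Downfold.EmeryAxialConductionBand
import HarnessLib

/-!
# HgBa₂CaCu₂O₆₊δ (box #257 Hg-1212, (K) source rows): the axial co-shift census ON THE TYPED BOX `emeryBoxHg1212K26Src` — verdicts against the object-E row
# `t′/t ∈ [-0.524, -0.423]` and their FOUR-ORBITAL reading (companion of `EmeryAxialSlabHg1212Windows`, which carries the method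
# docstring, the slab table and the raw slab windows; the kernel certificates are in `EmeryAxialSlabHg1212Subs*`)

Venture CertifiedManyBodySolver, cell `pub/hubbard-downfold` (stage S1), seat hubbard-downfold-mod-4 (technique B); namespace
`Summit.Ventures.CertifiedManyBodySolver.Downfold.Emery`. Everything PROVED. READING (certified): `a ∈ [0, 0.3]` ⇒ the co-shifted Fermi surface is STILL LESS cuprate-like than the E row (`t′/t > -0.423`): the REQUIRED axial admixture at the Fermi level is `a_F > 0.3` eV (`emeryBoxHg1212K26Src_axial_short`).
WHAT THIS IS NOT: not a statement that the material's parameters ARE in the box (SCREENING-GRADE provenance); `U = 0` band kinematics; no phase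
sentence; the E row is a [float] literature refit; `a_F` is the ADDITIONAL admixture beyond the box's σ rows (a model-form distance).
Sources: [AndersenEtAl1995, §§5–6]; [PavariniEtAl2001, Eqs. (1)–(3), Fig. 3]; [HybertsenSchluterChristensen1989, Eq. (1)].
-/

noncomputable section

namespace Summit.Ventures.CertifiedManyBodySolver.Downfold.Emery

open Real Set
open Summit.Ventures.CertifiedManyBodySolver.Downfold

/-! ## §2 The typed box and the co-shift as a parameter -/

/-- The one-body rows and the per-spin filling of `emeryBoxHg1212K26Src` read by this file. [folklore] -/
theorem emeryBoxHg1212K26Src_axRows {p : EmeryCoord → ℝ} (hp : emeryBoxHg1212K26Src.Mem p) :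
    p .DeltaPd ∈ Set.Icc (37 / 20 : ℝ) (49 / 20 : ℝ) ∧ p .tpd ∈ Set.Icc (241 / 200 : ℝ) (32 / 25 : ℝ) ∧
      p .tpp ∈ Set.Icc (161 / 250 : ℝ) (663 / 1000 : ℝ) ∧ p .tppP ∈ Set.Icc (163 / 1000 : ℝ) (187 / 1000 : ℝ) ∧
      (2 - p .nHoles) / 2 ∈ Set.Icc (2 / 5 : ℝ) (21 / 50 : ℝ) := by
  obtain ⟨hΔ, ha, hb, hc, hn⟩ := emeryBoxHg1212K26Src_mem_rows hp
  exact ⟨hΔ, ha, hb, hc, abFilling_rowBi2212_of_nHoles hn.1 hn.2 rfl⟩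

/-- **Slab 0 on the typed box**: for every parameter vector of `emeryBoxHg1212K26Src`, every co-shift `a ∈ [0, 0.15]` and every Fermi energy at
which the CO-SHIFTED σ antibonding band holds the box's electrons: `ε ∈ [1.1, 1.94]`, `t′/t ∈ [-0.3717, -0.2682]` (SHORT).
[folklore] -/
theorem emeryBoxHg1212K26Src_axSlab0 :
    HoldsOn (fun p : EmeryCoord → ℝ => ∀ a ε : ℝ, a ∈ Set.Icc (0 : ℝ) (3 / 20 : ℝ) →
      abFilling (p .DeltaPd) (p .tpd) (p .tpp + a) (p .tppP + a) ε = (2 - p .nHoles) / 2 →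
      ε ∈ Set.Icc (11 / 10 : ℝ) (97 / 50 : ℝ) ∧
      fsRatio (p .DeltaPd) (p .tpd) (p .tpp + a) (p .tppP + a) ε ∈ Set.Icc (-(3717 / 10000 : ℝ)) (-(1341 / 5000 : ℝ))) emeryBoxHg1212K26Src := by
  intro p hp a ε ha' hf
  obtain ⟨hΔ, ha, hb, hc, hν⟩ := emeryBoxHg1212K26Src_axRows hp
  rw [← hf] at hν
  exact hg1212AxSlab0_window hΔ ha ⟨by linarith [hb.1, ha'.1], by linarith [hb.2, ha'.2]⟩
    ⟨by linarith [hc.1, ha'.1], by linarith [hc.2, ha'.2]⟩ hν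

/-- **Slab 1 on the typed box**: for every parameter vector of `emeryBoxHg1212K26Src`, every co-shift `a ∈ [0.15, 0.3]` and every Fermi energy at
which the CO-SHIFTED σ antibonding band holds the box's electrons: `ε ∈ [1.04, 1.84]`, `t′/t ∈ [-0.4192, -0.322]` (SHORT).
[folklore] -/
theorem emeryBoxHg1212K26Src_axSlab1 :
    HoldsOn (fun p : EmeryCoord → ℝ => ∀ a ε : ℝ, a ∈ Set.Icc (3 / 20 : ℝ) (3 / 10 : ℝ) →
      abFilling (p .DeltaPd) (p .tpd) (p .tpp + a) (p .tppP + a) ε = (2 - p .nHoles) / 2 →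
      ε ∈ Set.Icc (26 / 25 : ℝ) (46 / 25 : ℝ) ∧
      fsRatio (p .DeltaPd) (p .tpd) (p .tpp + a) (p .tppP + a) ε ∈ Set.Icc (-(262 / 625 : ℝ)) (-(161 / 500 : ℝ))) emeryBoxHg1212K26Src := by
  intro p hp a ε ha' hf
  obtain ⟨hΔ, ha, hb, hc, hν⟩ := emeryBoxHg1212K26Src_axRows hp
  rw [← hf] at hν
  exact hg1212AxSlab1_window hΔ ha ⟨by linarith [hb.1, ha'.1], by linarith [hb.2, ha'.2]⟩
    ⟨by linarith [hc.1, ha'.1], by linarith [hc.2, ha'.2]⟩ hν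

/-- **Slab 2 on the typed box**: for every parameter vector of `emeryBoxHg1212K26Src`, every co-shift `a ∈ [0.3, 0.35]` and every Fermi energy at
which the CO-SHIFTED σ antibonding band holds the box's electrons: `ε ∈ [1.04, 1.72]`, `t′/t ∈ [-0.4273, -0.3629]` (MEETS).
[folklore] -/
theorem emeryBoxHg1212K26Src_axSlab2 :
    HoldsOn (fun p : EmeryCoord → ℝ => ∀ a ε : ℝ, a ∈ Set.Icc (3 / 10 : ℝ) (7 / 20 : ℝ) →
      abFilling (p .DeltaPd) (p .tpd) (p .tpp + a) (p .tppP + a) ε = (2 - p .nHoles) / 2 →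
      ε ∈ Set.Icc (26 / 25 : ℝ) (43 / 25 : ℝ) ∧
      fsRatio (p .DeltaPd) (p .tpd) (p .tpp + a) (p .tppP + a) ε ∈ Set.Icc (-(4273 / 10000 : ℝ)) (-(3629 / 10000 : ℝ))) emeryBoxHg1212K26Src := by
  intro p hp a ε ha' hf
  obtain ⟨hΔ, ha, hb, hc, hν⟩ := emeryBoxHg1212K26Src_axRows hp
  rw [← hf] at hν
  exact hg1212AxSlab2_window hΔ ha ⟨by linarith [hb.1, ha'.1], by linarith [hb.2, ha'.2]⟩
    ⟨by linarith [hc.1, ha'.1], by linarith [hc.2, ha'.2]⟩ hν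

/-- **Slab 3 on the typed box**: for every parameter vector of `emeryBoxHg1212K26Src`, every co-shift `a ∈ [0.35, 0.4]` and every Fermi energy at
which the CO-SHIFTED σ antibonding band holds the box's electrons: `ε ∈ [1.04, 1.7]`, `t′/t ∈ [-0.439, -0.3737]` (MEETS).
[folklore] -/
theorem emeryBoxHg1212K26Src_axSlab3 :
    HoldsOn (fun p : EmeryCoord → ℝ => ∀ a ε : ℝ, a ∈ Set.Icc (7 / 20 : ℝ) (2 / 5 : ℝ) →
      abFilling (p .DeltaPd) (p .tpd) (p .tpp + a) (p .tppP + a) ε = (2 - p .nHoles) / 2 →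
      ε ∈ Set.Icc (26 / 25 : ℝ) (17 / 10 : ℝ) ∧
      fsRatio (p .DeltaPd) (p .tpd) (p .tpp + a) (p .tppP + a) ε ∈ Set.Icc (-(439 / 1000 : ℝ)) (-(3737 / 10000 : ℝ))) emeryBoxHg1212K26Src := by
  intro p hp a ε ha' hf
  obtain ⟨hΔ, ha, hb, hc, hν⟩ := emeryBoxHg1212K26Src_axRows hp
  rw [← hf] at hν
  exact hg1212AxSlab3_window hΔ ha ⟨by linarith [hb.1, ha'.1], by linarith [hb.2, ha'.2]⟩
    ⟨by linarith [hc.1, ha'.1], by linarith [hc.2, ha'.2]⟩ hν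

/-- **Slab 4 on the typed box**: for every parameter vector of `emeryBoxHg1212K26Src`, every co-shift `a ∈ [0.4, 0.45]` and every Fermi energy at
which the CO-SHIFTED σ antibonding band holds the box's electrons: `ε ∈ [1.02, 1.68]`, `t′/t ∈ [-0.4496, -0.3843]` (MEETS).
[folklore] -/
theorem emeryBoxHg1212K26Src_axSlab4 :
    HoldsOn (fun p : EmeryCoord → ℝ => ∀ a ε : ℝ, a ∈ Set.Icc (2 / 5 : ℝ) (9 / 20 : ℝ) →
      abFilling (p .DeltaPd) (p .tpd) (p .tpp + a) (p .tppP + a) ε = (2 - p .nHoles) / 2 →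
      ε ∈ Set.Icc (51 / 50 : ℝ) (42 / 25 : ℝ) ∧
      fsRatio (p .DeltaPd) (p .tpd) (p .tpp + a) (p .tppP + a) ε ∈ Set.Icc (-(281 / 625 : ℝ)) (-(3843 / 10000 : ℝ))) emeryBoxHg1212K26Src := by
  intro p hp a ε ha' hf
  obtain ⟨hΔ, ha, hb, hc, hν⟩ := emeryBoxHg1212K26Src_axRows hp
  rw [← hf] at hν
  exact hg1212AxSlab4_window hΔ ha ⟨by linarith [hb.1, ha'.1], by linarith [hb.2, ha'.2]⟩
    ⟨by linarith [hc.1, ha'.1], by linarith [hc.2, ha'.2]⟩ hν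

/-- **Slab 5 on the typed box**: for every parameter vector of `emeryBoxHg1212K26Src`, every co-shift `a ∈ [0.45, 0.5]` and every Fermi energy at
which the CO-SHIFTED σ antibonding band holds the box's electrons: `ε ∈ [1.02, 1.68]`, `t′/t ∈ [-0.4606, -0.3934]` (MEETS).
[folklore] -/
theorem emeryBoxHg1212K26Src_axSlab5 :
    HoldsOn (fun p : EmeryCoord → ℝ => ∀ a ε : ℝ, a ∈ Set.Icc (9 / 20 : ℝ) (1 / 2 : ℝ) →
      abFilling (p .DeltaPd) (p .tpd) (p .tpp + a) (p .tppP + a) ε = (2 - p .nHoles) / 2 →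
      ε ∈ Set.Icc (51 / 50 : ℝ) (42 / 25 : ℝ) ∧
      fsRatio (p .DeltaPd) (p .tpd) (p .tpp + a) (p .tppP + a) ε ∈ Set.Icc (-(2303 / 5000 : ℝ)) (-(1967 / 5000 : ℝ))) emeryBoxHg1212K26Src := by
  intro p hp a ε ha' hf
  obtain ⟨hΔ, ha, hb, hc, hν⟩ := emeryBoxHg1212K26Src_axRows hp
  rw [← hf] at hν
  exact hg1212AxSlab5_window hΔ ha ⟨by linarith [hb.1, ha'.1], by linarith [hb.2, ha'.2]⟩
    ⟨by linarith [hc.1, ha'.1], by linarith [hc.2, ha'.2]⟩ hν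

/-- **Slab 6 on the typed box**: for every parameter vector of `emeryBoxHg1212K26Src`, every co-shift `a ∈ [0.5, 0.6]` and every Fermi energy at
which the CO-SHIFTED σ antibonding band holds the box's electrons: `ε ∈ [0.98, 1.7]`, `t′/t ∈ [-0.4807, -0.4007]` (MEETS).
[folklore] -/
theorem emeryBoxHg1212K26Src_axSlab6 :
    HoldsOn (fun p : EmeryCoord → ℝ => ∀ a ε : ℝ, a ∈ Set.Icc (1 / 2 : ℝ) (3 / 5 : ℝ) →
      abFilling (p .DeltaPd) (p .tpd) (p .tpp + a) (p .tppP + a) ε = (2 - p .nHoles) / 2 →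
      ε ∈ Set.Icc (49 / 50 : ℝ) (17 / 10 : ℝ) ∧
      fsRatio (p .DeltaPd) (p .tpd) (p .tpp + a) (p .tppP + a) ε ∈ Set.Icc (-(4807 / 10000 : ℝ)) (-(4007 / 10000 : ℝ))) emeryBoxHg1212K26Src := by
  intro p hp a ε ha' hf
  obtain ⟨hΔ, ha, hb, hc, hν⟩ := emeryBoxHg1212K26Src_axRows hp
  rw [← hf] at hν
  exact hg1212AxSlab6_window hΔ ha ⟨by linarith [hb.1, ha'.1], by linarith [hb.2, ha'.2]⟩
    ⟨by linarith [hc.1, ha'.1], by linarith [hc.2, ha'.2]⟩ hν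

/-! ## §3 The census verdicts against the E row -/

/-- **STILL SHORT OF THE E ROW for every co-shift `a ∈ [0, 0.3]`**: the co-shifted σ (= four-orbital at the Fermi level) `t′/t` stays ABOVE
`-0.423` — the one-band Fermi surface of record REQUIRES an axial admixture `a_F > 0.3` eV beyond the box's σ rows. [folklore] -/
theorem emeryBoxHg1212K26Src_axial_short :
    HoldsOn (fun p : EmeryCoord → ℝ => ∀ a ε : ℝ, a ∈ Set.Icc (0 : ℝ) (3 / 10 : ℝ) →
      abFilling (p .DeltaPd) (p .tpd) (p .tpp + a) (p .tppP + a) ε = (2 - p .nHoles) / 2 →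
      (-(423 / 1000 : ℝ)) < fsRatio (p .DeltaPd) (p .tpd) (p .tpp + a) (p .tppP + a) ε) emeryBoxHg1212K26Src := by
  intro p hp a ε ha' hf
  rcases mem_Icc_split ha' (3 / 20 : ℝ) with ha' | ha'
  · have h := (emeryBoxHg1212K26Src_axSlab0 p hp a ε ha' hf).2
    exact lt_of_lt_of_le (by norm_num) h.1
  · have h := (emeryBoxHg1212K26Src_axSlab1 p hp a ε ha' hf).2
    exact lt_of_lt_of_le (by norm_num) h.1

/-! ## §4 The four-orbital reading (transfer theorem `EmeryAxialConductionBand.condFilling_eq_abFilling`) -/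

/-- **FOUR-ORBITAL FORM OF THE SHORTFALL.** For every parameter vector of `emeryBoxHg1212K26Src`, EVERY axial level `ε_s` and coupling `t_sp`, and every
Fermi energy `ε < ε_s` at which the four-orbital CONDUCTION band (`EmeryBandEigenvalues.band4 … 1`) holds the box's electrons: if the axial admixture
at the Fermi level `t_sp²/(ε_s − ε)` is at most `0.3` eV, the conduction-band Fermi surface (an exact `t–t′` contour,
`EmeryAxialConductionBand.oneBand_of_band4_one_eq`) has `t′/t > -0.423` — it does NOT reproduce the object-E row. [cite: PavariniEtAl2001, Eqs. (1)–(3), Fig. 3] -/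
theorem emeryBoxHg1212K26Src_fourOrbital_short :
    HoldsOn (fun p : EmeryCoord → ℝ => ∀ εs tsp ε : ℝ, ε < εs →
      tsp ^ 2 / (εs - ε) ≤ (3 / 10 : ℝ) →
      condFilling (p .DeltaPd) εs (p .tpd) (p .tpp) (p .tppP) tsp ε = (2 - p .nHoles) / 2 →
      (-(423 / 1000 : ℝ)) < fsRatio (p .DeltaPd) (p .tpd) (p .tpp + tsp ^ 2 / (εs - ε)) (p .tppP + tsp ^ 2 / (εs - ε)) ε) emeryBoxHg1212K26Src := by
  intro p hp εs tsp ε hε ha hf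
  rw [condFilling_eq_abFilling hε] at hf
  exact emeryBoxHg1212K26Src_axial_short p hp _ ε ⟨div_nonneg (sq_nonneg _) (sub_pos.mpr hε).le, ha⟩ hf

end Summit.Ventures.CertifiedManyBodySolver.Downfold.Emery
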